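/-
Copyright (c) 2026 the pub-hodgecm-mathlib formalisation cell (harness21).  Prover seat hodgecm-mathlib-K2Liu-p09 (g4): Track B «K2-LIT», #184♮ = hLiu418,
payer-internal step «THE LOCAL DATUM AT A GOOD PLACE» of file #34 `Theorems/K2LiuDoublingZetaGL1.lean` (DEPMAP v2.9 §10 TABLE A∕B, §13; PLAN-O7 steps 6–7).
-/
import Summits.HodgeConjecture.HodgeConjecture.Theorems.K2LiuDoublingZetaGL1PlaceSplit       -- ★ (p857798): split good place
import Summits.HodgeConjecture.HodgeConjecture.Theorems.K2LiuDoublingZetaGL1PlaceInert       -- ★ (p857806): inert good place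
import Summits.HodgeConjecture.HodgeConjecture.Theorems.K2LiuDoublingZetaGL1LambdaSplit      -- ★ O4 (p857152)
import Summits.HodgeConjecture.HodgeConjecture.Theorems.K2LiuDoublingZetaGL1LambdaInert      -- ★ O4-inert (p857515)
import Summits.HodgeConjecture.HodgeConjecture.Theorems.K2LiuSphericalSectionLambdaLoc       -- ★ `exists_isSiegelIntDecomp`
import Summits.HodgeConjecture.HodgeConjecture.Theorems.K2LiuCartanFamilyInert               -- ★ `exists_generator_inert`
import Literature.NumberTheory.Automorphic.SelfDualLatticeCountFrameTransportCM               -- ★ `valued_toPlace_uniformizer`, `galAdicCompletionMap_toPlace_self`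
import Literature.NumberTheory.Automorphic.UnitaryGroupInertPlaceHyperbolicBasisDyadic        -- ★ `exists_glInt_placeForm_eq_formCongr_antidiagonal_of_isUnramifiedIn`
import HarnessLib

/-!
# Crux `HLiu418`, Track B road `K2_Liu`, file #34 — THE LOCAL DATUM OF THE SEAM AT A GOOD PLACE `v ∉ S`

Cell `hodgecm-mathlib`, crux item hLiu418 = `stmt-HodgeConjecture-24832`, route of record `HCCMUnconditional`; squad K2 ∕ K2Liu, prover K2Liu-p09 (g4).
THEOREMS ONLY (no `def`, no instance, no notation, no named-fact hypothesis, no `sorry`); lane `--supports stmt-HodgeConjecture-24832 --as helper`.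

For the assembly #34 of s23 `DoublingZetaGL1`: at ONE good place `v` of `L⁺` (the guards of ★ `K2LiuDoublingZetaGL1GoodPlaces.eventually_goodPlace`), with the
docked kernel `Λ_{s,v} := Λ_{s,v}^{diag} ∘ ι_v(·,1) ∘ β_v` (`β_v = localCongr g⁻¹`, `χ_D = λ̃⁻¹`), this file delivers EVERYTHING ★ #29s ∕ ★ #30s ∕ ★ #31s ask at `v`:
* §1 `integrable_and_integral_norm_le_of_map` — transport of `L¹`-bounds along an isomorphism of topological groups (Mathlib `integrable_map_equiv`).
* §2 `local_datum` — **THE LOCAL DATUM**: (Λ_K) `Λ_{s,v} = 1` on `K_{H,v}`; (Iw) the local Iwasawa decomposition of the doubled group at `v`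
  (★ `exists_isSiegelIntDecomp`); (Λ) `Λ_{s,v} ∈ L¹(ν_v)` with `∫‖Λ_{s,v}‖ ≤ 1 + C·q_v^{−Re s}` for `Re s ≥ 1`, `C` THE universal constant of ★ O4 ∕ O4-inert at
  `σ₀ = 1` (read through `Classical.choose`, so that it is the same at every place); and (E)+(H): `Θ₁, Θ₂` of norm `≤ 1` such that for every second slot and every
  `Re s > 0` some `c₀` satisfies ★ #29s's (E)_v for all translates and ★ #30s's cleared (H)_v with `ψ := Ψ`.  SPLIT `v`: ★ `eigen_split` + the `K^S`-transfer of
  ★ #33w + ★ `local_split`; INERT `v`: the inert frame (`ϖ = ι_w(ϖ_v)` ★ `valued_toPlace_uniformizer`, `T` ★ (K1⁺), `t₁` ★ `exists_generator_inert`), socket #24i's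
  conclusion at `w`, ★ `eigen_inert` + transfer + ★ `local_inert`.

HONEST LABEL: HC_CM is proved only modulo the printed citations (2 remaining named inputs: hLiu418 = stmt-HodgeConjecture-24832,
h413 = stmt-HodgeConjecture-24833) until rung 0 closes; this file is bookkeeping toward socket s23 and closes no item.
References: [Liu2021] App. D proof of Lem. D.1; [Li1992] §3 Thm. 3.1; [Liu2011] §2C (2-4); [GelbartRogawski1991] §3; [BruhatTits1972] (4.4.3).
-/

set_option autoImplicit false
set_option linter.dupNamespace false

noncomputable section

open scoped Matrix
open NumberField IsDedekindDomain MeasureTheory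
open Literature.NumberTheory.Automorphic Literature.NumberTheory.Automorphic.UnitaryGroup Literature.NumberTheory.Automorphic.IdeleClassGroup
open Literature.NumberTheory.Automorphic.Liu2021 Literature.NumberTheory.Automorphic.Liu2021.Def411WeilCarriers
open Literature.NumberTheory.GaloisRepresentations
open Literature.NumberTheory.GelbartRogawski1991 Literature.NumberTheory.GelbartRogawski1991.GRConstruction
open Literature.NumberTheory.K2Lit Literature.NumberTheory.K2Lit.SiegelDoubled
open Summit.HodgeConjecture.HodgeConjecture.Cruxes.HLiu418.K2LiuDoublingZetaGL1SplitBridge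
open Summit.HodgeConjecture.HodgeConjecture.Cruxes.HLiu418.K2LiuDoublingZetaGL1SplitIdentity
open Summit.HodgeConjecture.HodgeConjecture.Cruxes.HLiu418.K2LiuDoublingZetaGL1Docking
open Summit.HodgeConjecture.HodgeConjecture.Cruxes.HLiu418.K2LiuDoublingZetaGL1PlaceSplit
open Summit.HodgeConjecture.HodgeConjecture.Cruxes.HLiu418.K2LiuDoublingZetaGL1PlaceInert
open Summit.HodgeConjecture.HodgeConjecture.Cruxes.HLiu418.K2LiuDoublingZetaGL1LambdaSplit (exists_integral_norm_lambdaLoc_le)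
open Summit.HodgeConjecture.HodgeConjecture.Cruxes.HLiu418.K2LiuDoublingZetaGL1LambdaInert (exists_integral_norm_lambdaLoc_le_inert)

namespace Summit.HodgeConjecture.HodgeConjecture.Cruxes.HLiu418.K2LiuDoublingZetaGL1Local

/-! ## §1 Transport of `L¹`-bounds along an isomorphism of topological groups -/

/-- `F ∈ L¹(ν.map β)` with `∫‖F‖ ≤ B` gives `F ∘ β ∈ L¹(ν)` with `∫‖F ∘ β‖ ≤ B` (Mathlib `integrable_map_equiv`, `integral_map_equiv`). [cite: Liu2011, §2C p. 863] -/
theorem integrable_and_integral_norm_le_of_map {G G' : Type} [TopologicalSpace G] [TopologicalSpace G'] [MeasurableSpace G] [MeasurableSpace G']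
    [BorelSpace G] [BorelSpace G'] [Mul G] [Mul G'] (β : G ≃ₜ* G') (ν : Measure G) (F : G' → ℂ) {B : ℝ}
    (h : Integrable F (ν.map β) ∧ ∫ x, ‖F x‖ ∂(ν.map β) ≤ B) :
    Integrable (fun g => F (β g)) ν ∧ ∫ g, ‖F (β g)‖ ∂ν ≤ B := by
  set βm : G ≃ᵐ G' := β.toHomeomorph.toMeasurableEquiv with hβm
  have hcoe : (βm : G → G') = β := rfl
  rw [← hcoe] at h
  refine ⟨(integrable_map_equiv βm F).1 h.1, ?_⟩
  have h2 := integral_map_equiv (μ := ν) βm (fun x => ‖F x‖)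
  rw [h2] at h
  exact h.2

/-! ## §2 The local datum at a good place -/

set_option maxHeartbeats 2000000 in -- statement: the frame, O2's and #24i's conclusions by value, the docked kernel and the closed forms
/-- **THE LOCAL DATUM AT A GOOD PLACE `v`.**  See the module docstring.  Inputs: s23's frame (`H`, `dV`, `dW`, `t ≠ 0`, `g`, `hg`; `diag dV` hermitian invertible),
a discrete automorphic `P` of `U(H)`, a representation `σ` of `U(H)(𝔸_f)` with an intertwiner `f₀ : σ → P_f`, a compact open level `K` with `y ∈ σ^K`, the place guards at `v`,
O2's conclusion (★ #30a for `σ ∘ finAdelicCongr g`) and socket #24i's conclusion (for the same transported representation) BY VALUE at the places above `v`, a Haar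
`ν` on `U(H)(L⁺_v)` with `ν(K_{H,v}) = 1`, and a vector `w_P ∈ P`, `w_P ≠ 0`, `w_P =ᵐ φ₁`, which inherits every `K_{H,v}`-spherical Hecke eigen-identity of `f₀ y`
(the `K^S`-transfer clause of ★ #33w).  Output: (Λ_K), (Iw), (Λ) and `Θ₁, Θ₂` with (E)_v ∧ (H)_v for every second slot and every `Re s > 0`.
[cite: Liu2021, App. D proof of Lem. D.1 (p. 126)] [cite: Li1992, §3 Thm. 3.1] [cite: Liu2011, §2C (2-4) p. 863] [cite: GelbartRogawski1991, §3 (3.5)]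
[cite: BruhatTits1972, (4.4.3)] -/
theorem local_datum
    (L : Type) [Field L] [NumberField L] [IsCMField L] {n : ℕ} (e : Fin 2 × Fin 1 ≃ Fin n) (H : Matrix (Fin 2) (Fin 2) L)
    (dV : Fin 2 → L) (hdV : ∀ i, IsCMField.complexConj L (dV i) = dV i) (hdV0 : ∀ i, dV i ≠ 0)
    (dW : Fin 1 → L) (hdW : ∀ i, IsCMField.complexConj L (dW i) = dW i) (hdW0 : ∀ i, dW i ≠ 0)
    (t : L) (ht : t ≠ 0) (g : GL (Fin 2) L)
    (hg : formCongr ((IsCMField.complexConj L : L ≃ₐ[↥(maximalRealSubfield L)] L) : L →+* L) g (t • H) = Matrix.diagonal dV)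
    (hH' : ((Matrix.diagonal dV).map (IsCMField.complexConj L))ᵀ = Matrix.diagonal dV) (hHu' : IsUnit (Matrix.diagonal dV))
    (μ : Measure (adelicGroupData (↥(maximalRealSubfield L)) L (IsCMField.complexConj L) 2 H).automorphicQuotient)
    [(adelicGroupData (↥(maximalRealSubfield L)) L (IsCMField.complexConj L) 2 H).IsAutomorphicMeasure μ]
    (P : DiscreteAutomorphicRep (adelicGroupData (↥(maximalRealSubfield L)) L (IsCMField.complexConj L) 2 H) μ)
    {W : Type} [AddCommGroup W] [Module ℂ W] (σ : Representation ℂ (finAdelic (↥(maximalRealSubfield L)) L (IsCMField.complexConj L) 2 H) W)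
    (f₀ : σ.IntertwiningMap P.finRep)
    (K : Subgroup (finAdelic (↥(maximalRealSubfield L)) L (IsCMField.complexConj L) 2 H))
    (hKc : IsCompact (K : Set (finAdelic (↥(maximalRealSubfield L)) L (IsCMField.complexConj L) 2 H)))
    (hKo : IsOpen (K : Set (finAdelic (↥(maximalRealSubfield L)) L (IsCMField.complexConj L) 2 H)))
    (lam : Literature.NumberTheory.Automorphic.IdeleClassGroup L →ₜ* Circle) (hlam : IsConjugateSymplectic L lam)
    (χ : Chi (↥(maximalRealSubfield L)) L (IsCMField.complexConj L))
    (S₀ S₀' : Set (HeightOneSpectrum (𝓞 L))) (v : HeightOneSpectrum (𝓞 ↥(maximalRealSubfield L)))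
    -- the place guards at `v`
    (hK : UnitaryGroup.IsHyperspecialAt (↥(maximalRealSubfield L)) L (IsCMField.complexConj L) 2 H K v)
    (hβK : ∀ u : UnitaryGroup.localPi L (IsCMField.complexConj L) 2 H v,
      localCongr L (IsCMField.complexConj L) g⁻¹ (inv_ne_zero ht) (formCongr_inv_diagonal L H dV t ht g hg) v u ∈
          UnitaryGroup.localInt L (IsCMField.complexConj L) 2 (Matrix.diagonal dV) v ↔
        u ∈ UnitaryGroup.localInt L (IsCMField.complexConj L) 2 H v)
    (hS0 : ∀ w : UnitaryGroup.PlacesOver L v, w.1 ∉ S₀ ∧ w.1 ∉ S₀')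
    (hJi : ∀ w : UnitaryGroup.PlacesOver L v, (UnitaryGroup.isUnit_placeForm (Matrix.diagonal dV) hHu' w.1).unit ∈ glInt 2 (w.1.adicCompletion L))
    (hv : Algebra.IsUnramifiedIn (𝓞 L) v.asIdeal)
    (h2 : ∀ w' : UnitaryGroup.PlacesOver L v, ValuativeRel.valuation (w'.1.adicCompletion L) (2 : w'.1.adicCompletion L) = 1)
    (hdVw : ∀ (w' : UnitaryGroup.PlacesOver L v) (i : Fin 2),
      ValuativeRel.valuation (w'.1.adicCompletion L) (algebraMap L (w'.1.adicCompletion L) (dV i)) = 1)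
    (hT : ∀ (w' : UnitaryGroup.PlacesOver L v) (i j : Fin n), ValuativeRel.valuation (w'.1.adicCompletion L)
      (algebraMap L (w'.1.adicCompletion L) (algebraMap (↥(maximalRealSubfield L)) L (gramR L e dV hdV dW hdW i j))) ≤ 1)
    (hTinv : ∀ (w' : UnitaryGroup.PlacesOver L v) (i j : Fin n), ValuativeRel.valuation (w'.1.adicCompletion L)
      (algebraMap L (w'.1.adicCompletion L) (algebraMap (↥(maximalRealSubfield L)) L ((gramR L e dV hdV dW hdW)⁻¹ i j))) ≤ 1)
    (hlamU : ∀ w' : UnitaryGroup.PlacesOver L v, (toHeckeCharacter L lam).IsUnramifiedAt w'.1)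
    (hchiD : ∀ w' : UnitaryGroup.PlacesOver L v, (toHeckeCharacter L lam⁻¹).IsUnramifiedAt w'.1)
    (hchk : ∀ w' : UnitaryGroup.PlacesOver L v, (HeckeCharacter.checkOfChi (complexConj_mul_complexConj' L) χ).IsUnramifiedAt w'.1)
    -- O2's conclusion (★ #30a for `σ' = σ ∘ finAdelicCongr g`, `K' = (finAdelicCongr g)⁻¹ K`) at the split places above `v`, BY VALUE
    (h30a : haveI : Algebra.IsQuadraticExtension (↥(maximalRealSubfield L)) L := IsCMField.isQuadraticExtension L
      ∀ w : HeightOneSpectrum (𝓞 L), w.under (𝓞 ↥(maximalRealSubfield L)) = v → w ∉ S₀ → ∀ hw : IsCMField.complexConj L • w ≠ w,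
        (UnitaryGroup.isUnit_placeForm (Matrix.diagonal dV) hHu' w).unit ∈ glInt 2 (w.adicCompletion L) →
        ∀ K' : Subgroup ↥(finAdelic ↥(maximalRealSubfield L) L (IsCMField.complexConj L) 2 (Matrix.diagonal dV)),
          UnitaryGroup.IsHyperspecialAt ↥(maximalRealSubfield L) L (IsCMField.complexConj L) 2 (Matrix.diagonal dV) K' (w.under (𝓞 ↥(maximalRealSubfield L))) →
          ∀ y' ∈ Representation.fixedPoints (σ.comp (finAdelicCongr (↥(maximalRealSubfield L)) L (IsCMField.complexConj L) g ht hg).toMonoidHom) K',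
            UnitaryGroup.heckeTAt ↥(maximalRealSubfield L) L (IsCMField.complexConj L) 2 (Matrix.diagonal dV)
                (σ.comp (finAdelicCongr (↥(maximalRealSubfield L)) L (IsCMField.complexConj L) g ht hg).toMonoidHom) K'
                (⟨w, rfl⟩ : UnitaryGroup.PlacesOver L (w.under (𝓞 ↥(maximalRealSubfield L))))
                (IsCMField.complexConj_ne_one L) hH' hw (UnitaryGroup.isUnit_placeForm (Matrix.diagonal dV) hHu' w)
                (HeckeCharacter.uniformizer L w) 1 y' =
              ((muAlg L lam).valueAtUniformizer w +
                (HeckeCharacter.galConj (IsCMField.complexConj L) (muAlg L lam) *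
                  HeckeCharacter.checkOfChi (complexConj_mul_complexConj' L) χ).valueAtUniformizer w) • y' ∧
            (Ideal.absNorm w.asIdeal : ℂ) •
              UnitaryGroup.heckeTAt ↥(maximalRealSubfield L) L (IsCMField.complexConj L) 2 (Matrix.diagonal dV)
                (σ.comp (finAdelicCongr (↥(maximalRealSubfield L)) L (IsCMField.complexConj L) g ht hg).toMonoidHom) K'
                (⟨w, rfl⟩ : UnitaryGroup.PlacesOver L (w.under (𝓞 ↥(maximalRealSubfield L))))
                (IsCMField.complexConj_ne_one L) hH' hw (UnitaryGroup.isUnit_placeForm (Matrix.diagonal dV) hHu' w)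
                (HeckeCharacter.uniformizer L w) 2 y' =
              ((muAlg L lam).valueAtUniformizer w *
                (HeckeCharacter.galConj (IsCMField.complexConj L) (muAlg L lam) *
                  HeckeCharacter.checkOfChi (complexConj_mul_complexConj' L) χ).valueAtUniformizer w) • y')
    -- socket #24i's conclusion for `σ'' = σ ∘ finAdelicCongr g` at the inert places above `v`, BY VALUE
    (h24i : ∀ w : UnitaryGroup.PlacesOver L v, w.1 ∉ S₀' →
      ∀ (hw : IsCMField.complexConj L • w.1 = w.1) (_hv : Algebra.IsUnramifiedIn (𝓞 L) v.asIdeal)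
      (_h2 : ∀ w' : UnitaryGroup.PlacesOver L v, ValuativeRel.valuation (w'.1.adicCompletion L) (2 : w'.1.adicCompletion L) = 1)
      (_hdVw : ∀ (w' : UnitaryGroup.PlacesOver L v) (i : Fin 2),
        ValuativeRel.valuation (w'.1.adicCompletion L) (algebraMap L (w'.1.adicCompletion L) (dV i)) = 1)
      (ϖ : w.1.adicCompletion L) (_hϖ : Valued.v ϖ = WithZero.exp (-1 : ℤ))
      (_hϖσ : galAdicCompletionMap (L := L) (IsCMField.complexConj L) hw ϖ = ϖ)
      (T : GL (Fin 2) (w.1.adicCompletion L)) (_hTi : T ∈ glInt 2 (w.1.adicCompletion L))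
      (_hTJ : UnitaryGroup.placeForm (Matrix.diagonal dV) w.1 =
        formCongr (galAdicCompletionMap (L := L) (IsCMField.complexConj L) hw) T ((StdForm.antidiagonal 2).over (w.1.adicCompletion L)))
      (t₁ : UnitaryGroup.localPi L (IsCMField.complexConj L) 2 (Matrix.diagonal dV) v)
      (_ht₁ : (((t₁ : UnitaryGroup.LocalGLPi L 2 v) w : GL (Fin 2) (w.1.adicCompletion L)) : Matrix (Fin 2) (Fin 2) (w.1.adicCompletion L)) =
        ((T⁻¹ : GL (Fin 2) (w.1.adicCompletion L)) : Matrix (Fin 2) (Fin 2) (w.1.adicCompletion L)) *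
          Matrix.diagonal ![ϖ, ϖ⁻¹] * (T : Matrix (Fin 2) (Fin 2) (w.1.adicCompletion L)))
      (K' : Subgroup ↥(finAdelic ↥(maximalRealSubfield L) L (IsCMField.complexConj L) 2 (Matrix.diagonal dV))),
      UnitaryGroup.IsHyperspecialAt ↥(maximalRealSubfield L) L (IsCMField.complexConj L) 2 (Matrix.diagonal dV) K' v →
      ∀ y' ∈ Representation.fixedPoints (σ.comp (finAdelicCongr (↥(maximalRealSubfield L)) L (IsCMField.complexConj L) g ht hg).toMulEquiv.toMonoidHom) K',
      heckeOperator (σ.comp (finAdelicCongr (↥(maximalRealSubfield L)) L (IsCMField.complexConj L) g ht hg).toMulEquiv.toMonoidHom) K'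
        (UnitaryGroup.inclPlace ↥(maximalRealSubfield L) L (IsCMField.complexConj L) 2 (Matrix.diagonal dV) v t₁) y' =
      ((v.residueCard : ℂ) *
          ((toHeckeCharacter L lam).valueAtUniformizer w.1 + ((toHeckeCharacter L lam).valueAtUniformizer w.1)⁻¹) +
        (v.residueCard : ℂ) - 1) • y')
    (y : W) (hy : y ∈ σ.fixedPoints K)
    [MeasurableSpace (UnitaryGroup.localPi L (IsCMField.complexConj L) 2 H v)] [BorelSpace (UnitaryGroup.localPi L (IsCMField.complexConj L) 2 H v)]
    (ν : Measure (UnitaryGroup.localPi L (IsCMField.complexConj L) 2 H v)) [ν.IsHaarMeasure]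
    (hνK : ν (UnitaryGroup.localInt L (IsCMField.complexConj L) 2 H v : Set (UnitaryGroup.localPi L (IsCMField.complexConj L) 2 H v)) = 1)
    -- the vector `w_P` (★ #33w's continuous companion) and its first slot
    (wv : P.space.toSubmodule) (hw0 : wv ≠ 0)
    (φ₁ : (adelicGroupData (↥(maximalRealSubfield L)) L (IsCMField.complexConj L) 2 H).automorphicQuotient → ℂ)
    (hw1 : (((wv : (adelicGroupData (↥(maximalRealSubfield L)) L (IsCMField.complexConj L) 2 H).L2 μ)) :
        (adelicGroupData (↥(maximalRealSubfield L)) L (IsCMField.complexConj L) 2 H).automorphicQuotient → ℂ) =ᵐ[μ] φ₁)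
    (hwT : ∀ {ι : Type} (tt : ι → UnitaryGroup.localPi L (IsCMField.complexConj L) 2 H v) (a : ι → ℂ),
      IsSphericalHeckeEigen ν (UnitaryGroup.localInt L (IsCMField.complexConj L) 2 H v) tt
          (fun g' => P.space.toContRep (UnitaryGroup.inclPlaceAdelic (↥(maximalRealSubfield L)) L (IsCMField.complexConj L) 2 H v g')) (f₀ y) a →
        IsSphericalHeckeEigen ν (UnitaryGroup.localInt L (IsCMField.complexConj L) 2 H v) tt
          (fun g' => P.space.toContRep (UnitaryGroup.inclPlaceAdelic (↥(maximalRealSubfield L)) L (IsCMField.complexConj L) 2 H v g')) wv a) :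
    -- (Λ_K) the docked kernel is `1` on `K_{H,v}`
    (∀ (s : ℂ) (k : UnitaryGroup.localPi L (IsCMField.complexConj L) 2 H v), k ∈ UnitaryGroup.localInt L (IsCMField.complexConj L) 2 H v →
      LambdaLoc L e dV hdV dW hdW v (toHeckeCharacter L lam⁻¹) s
        (iotaLeftLocPi L e dV hdV dW hdW v
          (localCongr L (IsCMField.complexConj L) g⁻¹ (inv_ne_zero ht) (formCongr_inv_diagonal L H dV t ht g hg) v k)) = 1) ∧
    -- (Iw) local Iwasawa decomposition of the doubled group at `v`
    (∀ x : UnitaryGroup.localPi L (IsCMField.complexConj L) (n + n) (hermD L e dV hdV dW hdW) v,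
      ∃ p ∈ siegelDeltaLoc L e dV hdV dW hdW v,
        ∃ k ∈ UnitaryGroup.localInt L (IsCMField.complexConj L) (n + n) (hermD L e dV hdV dW hdW) v, x = p * k) ∧
    -- (Λ) integrability and the universal `L¹`-bound of the docked kernel for `Re s ≥ 1`
    (∀ s : ℂ, 1 ≤ s.re →
      Integrable (fun y => LambdaLoc L e dV hdV dW hdW v (toHeckeCharacter L lam⁻¹) s
        (iotaLeftLocPi L e dV hdV dW hdW v
          (localCongr L (IsCMField.complexConj L) g⁻¹ (inv_ne_zero ht) (formCongr_inv_diagonal L H dV t ht g hg) v y))) ν ∧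
      ∫ y, ‖LambdaLoc L e dV hdV dW hdW v (toHeckeCharacter L lam⁻¹) s
        (iotaLeftLocPi L e dV hdV dW hdW v
          (localCongr L (IsCMField.complexConj L) g⁻¹ (inv_ne_zero ht) (formCongr_inv_diagonal L H dV t ht g hg) v y))‖ ∂ν ≤
        1 + max (Classical.choose (exists_integral_norm_lambdaLoc_le 1 one_pos))
              (Classical.choose (exists_integral_norm_lambdaLoc_le_inert 1 one_pos)) * (v.residueCard : ℝ) ^ (-s.re)) ∧
    -- (E)+(H) with place constants `Θ₁, Θ₂` of norm `≤ 1`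
    ∃ Θ₁ Θ₂ : ℂ, ‖Θ₁‖ ≤ 1 ∧ ‖Θ₂‖ ≤ 1 ∧
      ∀ (φ₂L : (adelicGroupData (↥(maximalRealSubfield L)) L (IsCMField.complexConj L) 2 H).L2 μ)
        (φ₂ : (adelicGroupData (↥(maximalRealSubfield L)) L (IsCMField.complexConj L) 2 H).automorphicQuotient → ℂ),
        (((φ₂L : (adelicGroupData (↥(maximalRealSubfield L)) L (IsCMField.complexConj L) 2 H).L2 μ) :
          (adelicGroupData (↥(maximalRealSubfield L)) L (IsCMField.complexConj L) 2 H).automorphicQuotient → ℂ) =ᵐ[μ] φ₂) →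
        ∀ s : ℂ, 0 < s.re → ∃ c₀ : ℂ,
          (∀ tt : (adelicGroupData (↥(maximalRealSubfield L)) L (IsCMField.complexConj L) 2 H).Adelic,
            localZeta ν
                (fun y => LambdaLoc L e dV hdV dW hdW v (toHeckeCharacter L lam⁻¹) s
                  (iotaLeftLocPi L e dV hdV dW hdW v
                    (localCongr L (IsCMField.complexConj L) g⁻¹ (inv_ne_zero ht) (formCongr_inv_diagonal L H dV t ht g hg) v y)))
                (fun y => quotMatrixCoeff (adelicGroupData (↥(maximalRealSubfield L)) L (IsCMField.complexConj L) 2 H) μ φ₁ φ₂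
                  (tt * UnitaryGroup.inclPlaceAdelic (↥(maximalRealSubfield L)) L (IsCMField.complexConj L) 2 H v y)) =
              c₀ * quotMatrixCoeff (adelicGroupData (↥(maximalRealSubfield L)) L (IsCMField.complexConj L) 2 H) μ φ₁ φ₂ tt) ∧
          c₀ * ∏ᶠ w' : UnitaryGroup.PlacesOver L v,
              ((1 - (w'.1.residueCard : ℂ) ^ (-(s + 1 / 2))) *
                (1 - ((muAlg L lam)⁻¹ * (HeckeCharacter.galConj (IsCMField.complexConj L) (muAlg L lam) *
                    HeckeCharacter.checkOfChi (complexConj_mul_complexConj' L) χ)).valueAtUniformizer w'.1 * (w'.1.residueCard : ℂ) ^ (-(s + 1 / 2)))) =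
            (1 - Θ₁ * (v.residueCard : ℂ) ^ (-(2 * s + 2))) * (1 - Θ₂ * (v.residueCard : ℂ) ^ (-(2 * s + 1))) := by
  haveI : Algebra.IsQuadraticExtension (↥(maximalRealSubfield L)) L := IsCMField.isQuadraticExtension L
  -- Borel structure on the `U(diag dV)` side; the transported measure `ν.map β` is Haar with mass `1` on `K_{diag,v}`
  letI : MeasurableSpace (UnitaryGroup.localPi L (IsCMField.complexConj L) 2 (Matrix.diagonal dV) v) := borel _
  haveI : BorelSpace (UnitaryGroup.localPi L (IsCMField.complexConj L) 2 (Matrix.diagonal dV) v) := ⟨rfl⟩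
  have hν'K : (ν.map (localCongr L (IsCMField.complexConj L) g⁻¹ (inv_ne_zero ht) (formCongr_inv_diagonal L H dV t ht g hg) v))
      (UnitaryGroup.localInt L (IsCMField.complexConj L) 2 (Matrix.diagonal dV) v :
        Set (UnitaryGroup.localPi L (IsCMField.complexConj L) 2 (Matrix.diagonal dV) v)) = 1 :=
    (measure_map_eq_of_preimage (localCongr L (IsCMField.complexConj L) g⁻¹ (inv_ne_zero ht) (formCongr_inv_diagonal L H dV t ht g hg) v) ν _ _
      (UnitaryGroup.isOpen_localInt L (IsCMField.complexConj L) 2 (Matrix.diagonal dV) v) hβK).trans hνK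
  -- the two universal constants of ★ O4 ∕ O4-inert at `σ₀ = 1`
  have hC₁ := Classical.choose_spec (exists_integral_norm_lambdaLoc_le 1 one_pos)
  have hC₂ := Classical.choose_spec (exists_integral_norm_lambdaLoc_le_inert 1 one_pos)
  -- one place `w ∣ v`; make `v` syntactically `w ∩ 𝓞L⁺`
  obtain ⟨w₀⟩ : Nonempty (UnitaryGroup.PlacesOver L v) := inferInstance
  obtain ⟨w, hwv⟩ := w₀
  subst hwv
  refine ⟨fun s k hk => ?_, fun x => ?_, ?_, ?_⟩
  · -- (Λ_K)
    refine lambdaLoc_of_mem_localInt L e dV hdV dW hdW _ (toHeckeCharacter L lam⁻¹) s hchiD ?_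
    rw [iotaLeftLocPi_apply]
    exact iotaVLocPi_mem_localInt L e dV hdV dW hdW _ ((hβK k).2 hk) (one_mem _)
  · -- (Iw)
    obtain ⟨pk, h1, h2', h3⟩ := K2LiuSphericalSectionLambdaLoc.exists_isSiegelIntDecomp L e dV hdV dW hdW _ hdV0 hdW0 h2 hT hTinv x
    exact ⟨pk.1, h1, pk.2, h2', h3⟩
  · -- (Λ) the `L¹`-bound, split or inert
    intro s hs
    have hq1 : (1 : ℝ) ≤ ((w.under (𝓞 ↥(maximalRealSubfield L))).residueCard : ℝ) := by exact_mod_cast (HeightOneSpectrum.one_lt_residueCard _).le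
    by_cases hw : IsCMField.complexConj L • w = w
    · -- inert: the frame, then ★ O4-inert, exponent `2 Re s ≥ Re s`
      obtain ⟨T, hTi, hTJ⟩ := exists_glInt_placeForm_eq_formCongr_antidiagonal_of_isUnramifiedIn (↥(maximalRealSubfield L)) L (IsCMField.complexConj L)
        (IsCMField.complexConj_ne_one L) 2 (Matrix.diagonal dV) hH' (w.under (𝓞 ↥(maximalRealSubfield L))) ⟨w, rfl⟩ hw hv
        (UnitaryGroup.isUnit_placeForm (Matrix.diagonal dV) hHu' w) (hJi ⟨w, rfl⟩)
      obtain ⟨t₁, ht₁⟩ := K2LiuCartanFamilyInert.exists_generator_inert L dV (w.under (𝓞 ↥(maximalRealSubfield L))) ⟨w, rfl⟩ hw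
        (valued_toPlace_uniformizer L (w.under (𝓞 ↥(maximalRealSubfield L))) ⟨w, rfl⟩ hv)
        (galAdicCompletionMap_toPlace_self L (w.under (𝓞 ↥(maximalRealSubfield L))) ⟨w, rfl⟩ hw _) T hTJ
      have h := hC₂.2 L e dV hdV hdV0 dW hdW hdW0 (w.under (𝓞 ↥(maximalRealSubfield L))) ⟨w, rfl⟩ hw hv h2 hdVw hT hTinv (toHeckeCharacter L lam⁻¹)
        (isUnitary_toHeckeCharacter L lam⁻¹) hchiD s hs _ hν'K _ (valued_toPlace_uniformizer L (w.under (𝓞 ↥(maximalRealSubfield L))) ⟨w, rfl⟩ hv)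
        (galAdicCompletionMap_toPlace_self L (w.under (𝓞 ↥(maximalRealSubfield L))) ⟨w, rfl⟩ hw _) T hTi hTJ t₁ ht₁
      obtain ⟨hi, hb⟩ := integrable_and_integral_norm_le_of_map _ ν _ h
      refine ⟨hi, hb.trans ?_⟩
      have hle : ((w.under (𝓞 ↥(maximalRealSubfield L))).residueCard : ℝ) ^ (-(2 * s.re)) ≤ ((w.under (𝓞 ↥(maximalRealSubfield L))).residueCard : ℝ) ^ (-s.re) :=
        Real.rpow_le_rpow_of_exponent_le hq1 (by linarith)
      nlinarith [hC₂.1, le_max_right (Classical.choose (exists_integral_norm_lambdaLoc_le 1 one_pos))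
        (Classical.choose (exists_integral_norm_lambdaLoc_le_inert 1 one_pos)),
        Real.rpow_nonneg (le_trans zero_le_one hq1) (-s.re)]
    · -- split: ★ O4, `q_w = q_v`
      have h := hC₁.2 L e dV hdV hdV0 dW hdW hdW0 (w.under (𝓞 ↥(maximalRealSubfield L))) ⟨w, rfl⟩ hw h2 hdVw hT hTinv (toHeckeCharacter L lam⁻¹)
        (isUnitary_toHeckeCharacter L lam⁻¹) hchiD s hs _ hν'K
      obtain ⟨hi, hb⟩ := integrable_and_integral_norm_le_of_map _ ν _ h
      refine ⟨hi, hb.trans ?_⟩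
      have hqw : ((⟨w, rfl⟩ : UnitaryGroup.PlacesOver L (w.under (𝓞 ↥(maximalRealSubfield L)))).1.residueCard : ℝ) = ((w.under (𝓞 ↥(maximalRealSubfield L))).residueCard : ℝ) := by
        rw [HeightOneSpectrum.residueCard, HeightOneSpectrum.residueCard,
          absNorm_eq_absNorm_under_of_smul_ne (↥(maximalRealSubfield L)) (IsCMField.complexConj L) hw]
      rw [hqw]
      nlinarith [hC₁.1, le_max_left (Classical.choose (exists_integral_norm_lambdaLoc_le 1 one_pos))
        (Classical.choose (exists_integral_norm_lambdaLoc_le_inert 1 one_pos)),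
        Real.rpow_nonneg (le_trans zero_le_one hq1) (-s.re)]
  · -- (E)+(H): split or inert
    -- the docking in the `κ = localCongr g` direction and the pulled-back level
    have hκ : ∀ u : UnitaryGroup.localPi L (IsCMField.complexConj L) 2 (Matrix.diagonal dV) (w.under (𝓞 ↥(maximalRealSubfield L))),
        localCongr L (IsCMField.complexConj L) g ht hg (w.under (𝓞 ↥(maximalRealSubfield L))) u ∈ UnitaryGroup.localInt L (IsCMField.complexConj L) 2 H (w.under (𝓞 ↥(maximalRealSubfield L))) ↔
          u ∈ UnitaryGroup.localInt L (IsCMField.complexConj L) 2 (Matrix.diagonal dV) (w.under (𝓞 ↥(maximalRealSubfield L))) := by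
      intro u
      rw [localCongr_eq_symm_localCongr_inv g ht hg (formCongr_inv_diagonal L H dV t ht g hg)]
      refine (hβK _).symm.trans ?_
      rw [ContinuousMulEquiv.apply_symm_apply]
    have hK' := isHyperspecialAt_comap g ht hg hK hκ
    by_cases hw : IsCMField.complexConj L • w = w
    · -- INERT
      obtain ⟨T, hTi, hTJ⟩ := exists_glInt_placeForm_eq_formCongr_antidiagonal_of_isUnramifiedIn (↥(maximalRealSubfield L)) L (IsCMField.complexConj L)
        (IsCMField.complexConj_ne_one L) 2 (Matrix.diagonal dV) hH' (w.under (𝓞 ↥(maximalRealSubfield L))) ⟨w, rfl⟩ hw hv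
        (UnitaryGroup.isUnit_placeForm (Matrix.diagonal dV) hHu' w) (hJi ⟨w, rfl⟩)
      obtain ⟨t₁, ht₁⟩ := K2LiuCartanFamilyInert.exists_generator_inert L dV (w.under (𝓞 ↥(maximalRealSubfield L))) ⟨w, rfl⟩ hw
        (valued_toPlace_uniformizer L (w.under (𝓞 ↥(maximalRealSubfield L))) ⟨w, rfl⟩ hv)
        (galAdicCompletionMap_toPlace_self L (w.under (𝓞 ↥(maximalRealSubfield L))) ⟨w, rfl⟩ hw _) T hTJ
      -- socket #24i at `w` for the pulled-back level, STAGE 1, transfer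
      have h24 := h24i ⟨w, rfl⟩ (hS0 ⟨w, rfl⟩).2 hw hv h2 hdVw _ (valued_toPlace_uniformizer L (w.under (𝓞 ↥(maximalRealSubfield L))) ⟨w, rfl⟩ hv)
        (galAdicCompletionMap_toPlace_self L (w.under (𝓞 ↥(maximalRealSubfield L))) ⟨w, rfl⟩ hw _) T hTi hTJ t₁ ht₁ _ hK'
      have heig := hwT _ _ (eigen_inert L dV H t ht g hg μ P σ f₀ K hKc hKo w hK t₁ _ h24 y hy ν hνK)
      refine ⟨(toHeckeCharacter L lam⁻¹).valueAtUniformizer w, -(toHeckeCharacter L lam⁻¹).valueAtUniformizer w,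
        (norm_theta_inert L lam w).1, (norm_theta_inert L lam w).2, fun φ₂L φ₂ hφ₂ s hs => ?_⟩
      exact local_inert L dV e H hdV hdV0 dW hdW hdW0 t ht g hg μ lam hlam χ w hw hv h2 hdVw hT hTinv hβK hchiD (hlamU ⟨w, rfl⟩)
        (hchk ⟨w, rfl⟩) s hs ν hνK _ (valued_toPlace_uniformizer L (w.under (𝓞 ↥(maximalRealSubfield L))) ⟨w, rfl⟩ hv)
        (galAdicCompletionMap_toPlace_self L (w.under (𝓞 ↥(maximalRealSubfield L))) ⟨w, rfl⟩ hw _) T hTi hTJ t₁ ht₁ P wv hw0 φ₂L φ₁ φ₂ hw1 hφ₂ heig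
    · -- SPLIT
      have h30 := h30a w rfl (hS0 ⟨w, rfl⟩).1 hw (hJi ⟨w, rfl⟩) _ hK'
      have heig := hwT _ _ (eigen_split L dV hH' hHu' H t ht g hg μ P σ f₀ K w hw hK hβK (hJi ⟨w, rfl⟩) _ _ h30 y hy ν hνK)
      -- `λ̃` and `Ψ` unramified at `w̄ = c • w` (a place above `v`)
      have hwbar : (IsCMField.complexConj L • w).under (𝓞 ↥(maximalRealSubfield L)) = w.under (𝓞 ↥(maximalRealSubfield L)) := HeightOneSpectrum.under_algEquiv_smul (F := ↥(maximalRealSubfield L)) L (IsCMField.complexConj L) w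
      have hunr : (toHeckeCharacter L lam).IsUnramifiedAt (IsCMField.complexConj L • w) := hlamU ⟨_, hwbar⟩
      have hΨ := K2LiuDoublingZetaGL1Character.isUnramifiedAt_character L lam χ (IsCMField.complexConj L • w) hunr
        (by rw [smul_smul, complexConj_mul_complexConj' L, one_smul]; exact hlamU ⟨w, rfl⟩) (hchk ⟨_, hwbar⟩)
      refine ⟨_, _, norm_theta_split L lam (⟨w, rfl⟩ : UnitaryGroup.PlacesOver L (w.under (𝓞 ↥(maximalRealSubfield L)))),
        norm_theta_split L lam (⟨w, rfl⟩ : UnitaryGroup.PlacesOver L (w.under (𝓞 ↥(maximalRealSubfield L)))), fun φ₂L φ₂ hφ₂ s hs => ?_⟩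
      exact local_split L dV hH' hHu' e H hdV hdV0 dW hdW hdW0 t ht g hg μ lam hlam χ w hw h2 hdVw hT hTinv hβK hchiD hunr hΨ s hs ν hνK
        P wv hw0 φ₂L φ₁ φ₂ hw1 hφ₂ heig

end Summit.HodgeConjecture.HodgeConjecture.Cruxes.HLiu418.K2LiuDoublingZetaGL1Local

end
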